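import Literature.AnabelianGeometry.AbsoluteAnabelian.ArchimedeanReconstructionCor29PrimeProofs
import Literature.AnabelianGeometry.AbsoluteAnabelian.ArchimedeanReconstructionCor29GenuineInstance
import HarnessLib

/-!
# [AbsTopIII] Cor 2.9, the successor `GlobalArchimedeanCompatibility'` at the GENUINE NF-points and the
# genuine extended evaluation of `D : NFCurveData` (chart-package hypothesis)

S. Mochizuki, *Topics in absolute anabelian geometry III* [AbsTopIII] (bib key `MochizukiAbsTopIII2015`;
kurims manuscript, render p0063–p0065), Corollary 2.9, p.64 l.37 – p.65 l.34; Cor 2.8 (a)/(b) p.63.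

PROOF-ONLY (one theorem, no definition).  abc-iut cell, row «COR29b-RETYPE» (abc-iut-L4-lead RULINGS #8a /
#8d: "COR29b-RETYPE … will CITE p438727 by name"); seat abc-iut-L4-t4 gen 7.  abc-iut-w4-d104's
`ArchimedeanReconstructionCor29GenuineInstance.lean` (p438727, row «COR29-GENUINE-INSTANTIATE») specialises the
chart-package instance of the RECORD to the genuine terms of the datum: `isNFPoint x` := "`x` is the class of a
Cauchy sequence of NF-points converging to an NF-point `P`" (`f(x_j) → f(P)` for every `f` regular at `P`;
print p.63 (a)), `fval f x` := the genuine extended evaluation `limUnder_j f(x_j)` along a representative,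
`vanishesAt f x` := `fval f x = 0`.  This file does the same for the SUCCESSOR statement of record
`GlobalArchimedeanCompatibility'` (`ArchimedeanReconstructionCor29Prime.lean`, p439757; clause (b) at print
strength — a topological FIELD isomorphism `ℂ ⥲ k_v` pinned to `ι_{U_X,x}`), with VERBATIM the binders of
`NFCurveData.globalArchimedeanCompatibility_genuine`:

* `NFCurveData.globalArchimedeanCompatibility'_genuine` — by `NFCurveData.globalArchimedeanCompatibility'_of_chartPackage`
  (p439772) exactly as p438727 obtains the record from p436603.

HONEST SCOPE (= p438727's): the chart package `hpkg`/`hG`/`hspan` at the genuine NF-points is a NAMED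
hypothesis (the analytic structure of `X_v(k_v)` and "NF-rational functions are holomorphic in the Cor 2.8
charts", owed by the Thm 1.9 / Cor 2.8 lineage); `L` is the constant pull-back of the plane's germ structure,
not yet Cor 2.7 (e)'s structure of `𝕏_v` (abc-iut-f-075 R2 (i); pending «COR27e»); the local additive
structures come from the chart binder (R4); existence of Cauchy sequences converging to NF-points is not
assumed (vacuous where absent); functoriality record-only.  Refereed pre-IUT material; nothing here bears on
the disputed [IUTchIII] Cor. 3.12; typed ≠ proved.
-/

noncomputable section

namespace Literature.AnabelianGeometry.AbsoluteAnabelian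

open _root_.Set _root_.Filter _root_.Topology _root_.Metric _root_.Function

namespace ArchimedeanReconstruction

open Cor29 Cor29ChartPackage

open Classical in
/-- **[AbsTopIII] Cor 2.9 — the SUCCESSOR statement of record `GlobalArchimedeanCompatibility'` (clause (b)
at print strength: an isomorphism of topological FIELDS `ℂ ⥲ k_v` pinned to the `ι_{U_X,x}`, compatible with
the `𝒜_{x₁} ⥲ 𝒜_{x₂}`) for `D : NFCurveData` at the GENUINE NF-points and the GENUINE extended evaluation**,
under the chart-package hypothesis — verbatim the binders of abc-iut-w4-d104's
`NFCurveData.globalArchimedeanCompatibility_genuine` (p438727): `isNFPoint x` := "`x` is the class of a Cauchy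
sequence of NF-points converging to an NF-point `P`", `fval f x := limUnder_j f(x_j)`, `vanishesAt f x :=
fval f x = 0`; the chart package (charts to balls, chart expressions `G x f` of the values, a uniformiser) and
the field identification `κ : ℂ ⥲ k_v` are NAMED hypotheses; `L` the constant pull-back of the plane's germ
structure (caveat in the module docstring). [cite: MochizukiAbsTopIII2015, Corollary 2.9 pp.64–65] -/
theorem NFCurveData.globalArchimedeanCompatibility'_genuine (D : NFCurveData)
    (W : D.Xtop → Set D.Xtop) (e : D.Xtop → D.Xtop → ℂ) (e' : D.Xtop → ℂ → D.Xtop) (r : D.Xtop → ℝ)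
    (G : D.Xtop → D.Fn → ℂ → ℂ) (κ : ℂ ≃+* D.kv) (hκ : Continuous κ) (hκ' : Continuous κ.symm)
    (hpkg : ∀ x : D.Xtop,
      (∃ (P : D.Pt) (s : {x : ℕ → D.Pt // D.IsCauchy x}), Quot.mk _ s = x ∧
        ∀ f : D.Fn, D.eval f P ≠ none → Tendsto (fun j => D.valv f (s.1 j)) atTop (𝓝 (D.valv f P))) →
      0 < r x ∧ IsOpen (W x) ∧ x ∈ W x ∧ ContinuousOn (e x) (W x) ∧
        MapsTo (e x) (W x) (ball (e x x) (r x)) ∧ ContinuousOn (e' x) (ball (e x x) (r x)) ∧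
        MapsTo (e' x) (ball (e x x) (r x)) (W x) ∧ (∀ v ∈ W x, e' x (e x v) = v) ∧
        ∀ w ∈ ball (e x x) (r x), e x (e' x w) = w)
    (hG : ∀ x : D.Xtop,
      (∃ (P : D.Pt) (s : {x : ℕ → D.Pt // D.IsCauchy x}), Quot.mk _ s = x ∧
        ∀ f : D.Fn, D.eval f P ≠ none → Tendsto (fun j => D.valv f (s.1 j)) atTop (𝓝 (D.valv f P))) →
      ∀ f : D.Fn, limUnder atTop (fun j => D.valv f ((Quot.out x).1 j)) = 0 →
        DifferentiableAt ℂ (G x f) (e x x) ∧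
          ∀ᶠ u in 𝓝 x, κ.symm (limUnder atTop (fun j => D.valv f ((Quot.out u).1 j))) = G x f (e x u))
    (hspan : ∀ x : D.Xtop,
      (∃ (P : D.Pt) (s : {x : ℕ → D.Pt // D.IsCauchy x}), Quot.mk _ s = x ∧
        ∀ f : D.Fn, D.eval f P ≠ none → Tendsto (fun j => D.valv f (s.1 j)) atTop (𝓝 (D.valv f P))) →
      ∃ f : D.Fn, limUnder atTop (fun j => D.valv f ((Quot.out x).1 j)) = 0 ∧ deriv (G x f) (e x x) ≠ 0) :
    GlobalArchimedeanCompatibility' D (Cor29Model.planeStructure.comap (fun _ : D.Xtop => (0 : ℂ)))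
      (fun x => ∃ (P : D.Pt) (s : {x : ℕ → D.Pt // D.IsCauchy x}), Quot.mk _ s = x ∧
        ∀ f : D.Fn, D.eval f P ≠ none → Tendsto (fun j => D.valv f (s.1 j)) atTop (𝓝 (D.valv f P)))
      (fun _ => D.kv) (fun x f => κ (deriv (G x f) (e x x)))
      (fun f x => limUnder atTop (fun j => D.valv f ((Quot.out x).1 j)) = 0)
      (fun x a b => e' x (e x a + e x b - e x x))
      (fun x n v => if v ∈ W x ∧ ‖e x v - e x x‖ < r x / 2 then e' x (e x x + (e x v - e x x) / (n : ℂ)) else x)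
      (fun f x => limUnder atTop (fun j => D.valv f ((Quot.out x).1 j)))
      (fun x u v => e' x (e x x +
        (((Cor29Model.mult 0 : (Cor29Model.planeStructure.comap (fun _ : D.Xtop => (0 : ℂ))).A x ≃ₜ* ℂˣ) u :
          ℂˣ) : ℂ) * (e x v - e x x))) :=
  D.globalArchimedeanCompatibility'_of_chartPackage _ W e e' r (fun x hx => (hpkg x hx).1)
    (fun x hx => ⟨(hpkg x hx).2.1, (hpkg x hx).2.2.1⟩)
    (fun x hx => ⟨(hpkg x hx).2.2.2.1, (hpkg x hx).2.2.2.2.1⟩)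
    (fun x hx => ⟨(hpkg x hx).2.2.2.2.2.1, (hpkg x hx).2.2.2.2.2.2.1⟩)
    (fun x hx => (hpkg x hx).2.2.2.2.2.2.2.1) (fun x hx => (hpkg x hx).2.2.2.2.2.2.2.2)
    _ _ G κ hκ hκ' (fun x hx f hf => ⟨(hG x hx f hf).1, (hG x hx f hf).2, hf⟩) (fun _ _ h => h) hspan

end ArchimedeanReconstruction

end Literature.AnabelianGeometry.AbsoluteAnabelian

end
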